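import Summits.Ventures.HSemireg.Pad4FirstOrderModel

/-!
# Venture HSemireg — kernel checks of the PAD-4 first-order model (companion of `Pad4FirstOrderModel.lean`, row 716)

HONEST FRAMING. PROVED bookkeeping about the DEFINITIONS of `Pad4FirstOrderModel.lean` (p505821; typer lineage
hodge-lit-semireg-typer g6 §A, g7 §B–§C, 2026-08-27). Each item turns a sentence that the model file's docstring states in
WORDS into a kernel theorem over the landed `def`s; nothing here proves `TheoremLZeta` ∕ `TheoremLZetaMain` (they stay
kernel-OPEN, `@[conjecture]`), nothing is TIER 2 (director-hodge g7 l.29811 «NOT now»), and nothing here says HC ∕ HC_CM ∕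
HC_AV holds; no fact, no definition, no instance, no notation.

§A (g6; pre-read PASS lit-semireg-ref g15, section text c67118ad07327fac). (1) `ob_single_eq_zero` — the demand `ob_κ(X)` has
no `Λ²V_f`-component (null letters have `α = α'`; PAD4-FIRSTORDER §1 «(α′_g − α_g)k_{gg}», PAD4-DIAGCLOSURE §0): the words
«computed, not assumed» of the model file are now «proved». (2) `idxH0_nonempty_iff` — the model has an entry space
`H⁰(Y − X) ≠ 0` iff `Y` and `X` lie in one layer and on every factor `X` is uncharged or carries `Y`'s phase with charge `≤`
— PAD4-THEOREM-L §5 (P0) in the kernel, the same statement as gs-eng-2's `Pad4PhaseKernelCertificate.effectivity_rule`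
(row 717; no import between the files).

§B (g7) REMARK N IN THE MODEL (PAD4-THEOREM-L v1.2 (6.1); the model file's FAITHFULNESS (b)(i) «in a kept LOWER row no
cross-phase unknown occurs», the referees' «sentence that makes the transfer work»): `rel_ne_dead_of_row` ∕
`lowerRow_unknown_pure` — if the row class `R − X` is not `dead` on a factor and an entry `P′ → R` exists there, then the
unknown class `P′ − X` is not `dead` on that factor; so `LowerColumnSolvable` needs no purity guard, in contrast with the
`E₊` side (`UpperRowPure`, faithfulness read s4-search-1 g20 5cfea059015d0a70 P1). With `rel_ne_dead_iff` (a factor is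
non-`dead` iff same layer and one side uncharged or equal phases) and `rel_eq_of_idx_zero_nonempty` (an effective factor
class is `zero` or the positive letter `(c_Y − c_X) ℓ_{ζ_Y}`).

§C (g7) NATURALITY OF THE DEMAND (the model file's FAITHFULNESS (b)(ii) «naturality `(ob_{P″} − ob_P)·g = 0`,
`g ∈ H⁰(P″ − P)`, holds in the model: the `V_f`-factor `ξ̄_ζ` of each term of `κ ∪ c₁(P″ − P)` is killed by `w_ζ`» — the
identity under which (E1) is invariant under the unipotent change of splitting of `E₊` in PAD4-THEOREM-L §2–§3):
`ob_mul_section_natural` — for any constituents `P″`, `P`, any `κ`, any section coordinates `g` on `idxH0 P″ P` and any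
target coordinate `(q, o)`, the products `ob_κ(P″)·g` and `ob_κ(P)·g` in `H²(P″ − P)` (the model's product `coefProd` with
unknown class `0` and section class `P″ − P`, summed over the unknown coordinates `ι` of `H^q(0)`) are EQUAL. Engine:
`sum_coefProd_mul_obTerm_eq_zero` — on a factor `f` where the section class is a positive letter of phase `i^k`, the
`f`-term of a demand of phase `k` dies after the `ι_f`-sum, because `V·R_e → R_e ⊗ W` is `w_ζ` (`coef_zero_one_pos`),
`Λ²V·R_e = 0` (`coef_zero_two_pos`) and `w_ζ(ē_A)·1 + w_ζ(ē_B)·ζ̄ = −ζ̄ + ζ̄ = 0` (`wCoef_xiBar_cancel`; the two unknown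
coordinates `ē_A`, `ē_B` are paired by `Finset.sum_involution`). The factor-by-factor reduction uses
`rel_eq_of_idx_zero_nonempty`: where `P″` and `P` carry the same letter the two `f`-terms coincide, where they differ the
section class is `(c″ − c) ℓ_ζ` with `ζ` the phase of `P″` (and of `P` unless `P` is uncharged there) and both `f`-terms
vanish by the engine.

Validated on the farm against the LANDED row-716 module (rc 0, 0 warnings, 0 sorries; `#print axioms` standard).
SOURCES as in the model file (PAD4-THEOREM-L v1.2 66fb170a6cb906b7, PAD4-FIRSTORDER v1.1 93f71c42cb445756, PAD4-DIAGCLOSURE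
v1.2 7d6949f2a7067e18, PAD4-LEAK v1.0 30757ae6d074958d). Typed ≠ proved ≠ endorsed.
-/

noncomputable section
namespace Summit.Ventures.HSemireg.Pad4FirstOrder
open Finset

/-! ## §A The demand has no `Λ²V_f`-component; (P0) effectivity (typer g6) -/

/-- The demand has no `Λ²V_f`-component (null letters: `α = α'`): the `q = (2 at f₀)` coordinates of `ob` vanish. -/
theorem ob_single_eq_zero (X : Constituent) (κ : Matrix (Fin 4) (Fin 4) ℂ) (f₀ : Fin 4) (o : Fin 4 → ℕ × ℕ) :
    ob X κ (Pi.single f₀ 2) o = 0 := by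
  unfold ob
  refine Finset.sum_eq_zero fun f _ => Finset.sum_eq_zero fun τ _ => ?_
  have hne : Pi.single (M := fun _ : Fin 4 => ℕ) f₀ 2 ≠ qPair f τ := by
    intro h
    have := congrFun h f₀
    simp only [Pi.single_eq_same, qPair] at this
    split_ifs at this; omega
  have hz : zetaBar (X.phase f) * zetaC (X.phase f) = 1 := by
    unfold zetaBar
    exact inv_mul_cancel₀ (pow_ne_zero _ Complex.I_ne_zero)
  by_cases h1 : τ = f
  · rw [if_pos h1]
    by_cases h2 : Pi.single (M := fun _ : Fin 4 => ℕ) f₀ 2 = Pi.single f 2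
    · rw [if_pos h2]
      simp only [xiBar, kap, Prod.mk.injEq, and_true, one_ne_zero, if_false, if_true, zero_ne_one]
      linear_combination (-(X.charge f : ℂ) * κ f f) * hz
    · rw [if_neg h2, mul_zero]
  · rw [if_neg h1, if_neg hne, mul_zero]

/-- `idx r 0` is non-empty iff the per-factor class is `zero` or positive. -/
theorem idx_zero_nonempty_iff (r : Rel) : (idx r 0).Nonempty ↔ (r = Rel.zero ∨ ∃ e k, r = Rel.pos e k) := by
  cases r with
  | zero => simp [idx]
  | pos e k => exact ⟨fun _ => Or.inr ⟨e, k, rfl⟩, fun _ => ⟨(0, 0), by simp [idx, monIdx]⟩⟩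
  | neg d k => simp [idx]
  | dead => simp [idx]

/-- **(P0) in the model = gs-eng-2's `effectivity_rule`**: the entry space `H⁰(Y − X)` of the model is non-zero iff `Y` and
`X` lie in one layer and on every factor `X` is uncharged or carries `Y`'s phase with charge `≤`. -/
theorem idxH0_nonempty_iff (Y X : Constituent) :
    (idxH0 Y X).Nonempty ↔
      Y.layer = X.layer ∧ ∀ g, X.charge g = 0 ∨ (Y.phase g = X.phase g ∧ X.charge g ≤ Y.charge g) := by
  unfold idxH0
  rw [Fintype.piFinset_nonempty]
  simp only [idx_zero_nonempty_iff]
  constructor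
  · intro h
    have hl : Y.layer = X.layer := by
      by_contra hne
      rcases h 0 with h0 | ⟨e, k, h0⟩ <;> simp [rel, hne] at h0
    refine ⟨hl, fun g => ?_⟩
    rcases h g with h0 | ⟨e, k, h0⟩
    · unfold rel at h0
      split_ifs at h0 <;> omega
    · unfold rel at h0
      split_ifs at h0 <;> omega
  · rintro ⟨hl, h⟩ g
    rcases h g with h0 | ⟨hp, hc⟩
    · unfold rel
      split_ifs <;> first | (left; rfl) | (right; exact ⟨_, _, rfl⟩) | omega
    · unfold rel
      split_ifs <;> first | (left; rfl) | (right; exact ⟨_, _, rfl⟩) | omega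

/-! ## §B REMARK N in the model: kept lower rows see no cross-phase unknowns (typer g7) -/

/-- `rel X X g = zero` on every factor (a constituent minus itself is the class `0`). -/
theorem rel_self (X : Constituent) (g : Fin 4) : rel X X g = Rel.zero := by
  unfold rel
  split_ifs <;> first | rfl | omega

/-- a per-factor class is NOT `dead` iff the two constituents share the layer and, on this factor, one of them is
uncharged or the phases agree. -/
theorem rel_ne_dead_iff (Y X : Constituent) (g : Fin 4) :
    rel Y X g ≠ Rel.dead ↔ Y.layer = X.layer ∧ (Y.charge g = 0 ∨ X.charge g = 0 ∨ Y.phase g = X.phase g) := by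
  unfold rel
  split_ifs with h1 h2 h3 h4 h5
  · exact ⟨fun h => (h rfl).elim, fun h => absurd h.1 h1⟩
  · exact ⟨fun _ => ⟨not_ne_iff.mp h1, Or.inl h2.1⟩, fun _ => Rel.noConfusion⟩
  · exact ⟨fun _ => ⟨not_ne_iff.mp h1, Or.inr (Or.inl h3)⟩, fun _ => Rel.noConfusion⟩
  · exact ⟨fun _ => ⟨not_ne_iff.mp h1, Or.inl h4⟩, fun _ => Rel.noConfusion⟩
  · refine ⟨fun h => (h rfl).elim, fun h => ?_⟩
    rcases h.2 with h0 | h0 | h0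
    · exact absurd h0 h4
    · exact absurd h0 h3
    · exact absurd h0 h5
  all_goals exact ⟨fun _ => ⟨not_ne_iff.mp h1, Or.inr (Or.inr (not_ne_iff.mp h5))⟩, fun _ => Rel.noConfusion⟩

/-- sections only exist within one layer. -/
theorem layer_eq_of_idx_zero_nonempty (Y X : Constituent) (g : Fin 4) (h : (idx (rel Y X g) 0).Nonempty) :
    Y.layer = X.layer := by
  by_contra hne
  have : rel Y X g = Rel.dead := by unfold rel; rw [if_pos hne]
  rw [this] at h
  simp [idx] at h

/-- an EFFECTIVE per-factor class (a section coordinate exists) is `zero` — equal letters, or both uncharged — or the positive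
letter `(c_Y − c_X) ℓ_{ζ_Y}` with `c_X < c_Y`; in both cases `X` is uncharged there or the phases agree. -/
theorem rel_eq_of_idx_zero_nonempty (Y X : Constituent) (g : Fin 4) (h : (idx (rel Y X g) 0).Nonempty) :
    (rel Y X g = Rel.zero ∧ Y.charge g = X.charge g ∧ (X.charge g = 0 ∨ Y.phase g = X.phase g)) ∨
    (rel Y X g = Rel.pos (Y.charge g - X.charge g) (Y.phase g) ∧ X.charge g < Y.charge g ∧
      (X.charge g = 0 ∨ Y.phase g = X.phase g)) := by
  unfold rel at h ⊢
  split_ifs at h ⊢ with h1 h2 h3 h4 h5 h6 h7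
  · simp [idx] at h
  · exact Or.inl ⟨rfl, by omega, Or.inl h2.2⟩
  · exact Or.inr ⟨by rw [h3, Nat.sub_zero], by omega, Or.inl h3⟩
  · simp [idx] at h
  · simp [idx] at h
  · exact Or.inr ⟨rfl, h6, Or.inr (not_ne_iff.mp h5)⟩
  · simp [idx] at h
  · exact Or.inl ⟨rfl, by omega, Or.inr (not_ne_iff.mp h5)⟩

/-- **REMARK N in the model** (PAD4-THEOREM-L (6.1); FAITHFULNESS (b)(i) «in a kept LOWER row no cross-phase unknown
occurs»), per factor: if the row class `R − X` is not `dead` on `g` and an entry `P′ → R` exists on `g` (`H⁰(R − P′) ≠ 0`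
there), then the unknown class `P′ − X` is not `dead` on `g` either — so `LowerColumnSolvable` needs no purity guard
(contrast `UpperRowPure`: the `E₊`-side analogue fails off the diagonal, faithfulness read 5cfea059015d0a70 P1). -/
theorem rel_ne_dead_of_row (R P' X : Constituent) (g : Fin 4) (hR : rel R X g ≠ Rel.dead)
    (hφ : (idx (rel R P' g) 0).Nonempty) : rel P' X g ≠ Rel.dead := by
  have hl1 := (rel_ne_dead_iff R X g).mp hR
  have hl2 := layer_eq_of_idx_zero_nonempty R P' g hφ
  refine (rel_ne_dead_iff P' X g).mpr ⟨hl2.symm.trans hl1.1, ?_⟩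
  rcases rel_eq_of_idx_zero_nonempty R P' g hφ with ⟨_, hc, hp⟩ | ⟨_, hc, hp⟩
  · rcases hp with h0 | hRP
    · exact Or.inl h0
    · rcases hl1.2 with hR0 | hX0 | hRX
      · exact Or.inl (by omega)
      · exact Or.inr (Or.inl hX0)
      · exact Or.inr (Or.inr (hRP.symm.trans hRX))
  · rcases hp with h0 | hRP
    · exact Or.inl h0
    · rcases hl1.2 with hR0 | hX0 | hRX
      · exact absurd hR0 (by omega)
      · exact Or.inr (Or.inl hX0)
      · exact Or.inr (Or.inr (hRP.symm.trans hRX))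

/-- hence, for the whole design: every unknown `η_{P′}` that enters a KEPT lower row `R` of column `X` through an entry
`φ_{R P′} ≠ 0` (some section coordinate exists) has a non-`dead` class `P′ − X` on every factor where `R − X` is non-`dead`. -/
theorem lowerRow_unknown_pure (R P' X : Constituent) (hR : ∀ g, rel R X g ≠ Rel.dead)
    (hφ : (idxH0 R P').Nonempty) (g : Fin 4) : rel P' X g ≠ Rel.dead :=
  rel_ne_dead_of_row R P' X g (hR g) ((Fintype.piFinset_nonempty.mp hφ) g)

/-! ## §C Naturality of the demand: `(ob_κ(P″) − ob_κ(P))·g = 0` for `g ∈ H⁰(P″ − P)` (typer g7) -/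

/-- a product over the four factors vanishes as soon as one factor does. -/
theorem coefProd_eq_zero_of_factor (rU rS : Fin 4 → Rel) (q : Fin 4 → ℕ) (ι a o : Fin 4 → ℕ × ℕ) (f : Fin 4)
    (h : coef (rU f) (q f) (ι f) (rS f) (a f) (o f) = 0) : coefProd rU rS q ι a o = 0 :=
  Finset.prod_eq_zero (Finset.mem_univ f) h

/-- `Λ²V · R_e = 0`: a degree-`2` unknown coordinate on a factor whose section class is a positive letter contributes nothing. -/
theorem coef_zero_two_pos (ι : ℕ × ℕ) (e : ℕ) (k : Fin 4) (a o : ℕ × ℕ) :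
    coef Rel.zero 2 ι (Rel.pos e k) a o = 0 := by
  simp [coef]

/-- `V · R_e → R_e ⊗ W` is `w_ζ`: on a factor whose section class is a positive letter of phase `i^k` the degree-`1`
product has the coefficient `w_ζ(ι) · [o = a]`. -/
theorem coef_zero_one_pos (ι : ℕ × ℕ) (e : ℕ) (k : Fin 4) (a o : ℕ × ℕ) :
    coef Rel.zero 1 ι (Rel.pos e k) a o = wCoef k ι * (if o = a then 1 else 0) := by
  simp [coef]

/-- **`w_ζ(ξ̄_ζ) = 0`** in coordinates: `w_ζ(ē_A)·1 + w_ζ(ē_B)·ζ̄ = −ζ̄ + ζ̄ = 0`. -/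
theorem wCoef_xiBar_cancel (k : Fin 4) :
    wCoef k (0, 0) * xiBar k (0, 0) + wCoef k (1, 0) * xiBar k (1, 0) = 0 := by
  simp [wCoef, xiBar]

/-- `coefProd` splits off the factor `f`. -/
theorem coefProd_eq_mul_erase (rU rS : Fin 4 → Rel) (q : Fin 4 → ℕ) (ι a o : Fin 4 → ℕ × ℕ) (f : Fin 4) :
    coefProd rU rS q ι a o =
      coef (rU f) (q f) (ι f) (rS f) (a f) (o f) * ∏ g ∈ univ.erase f, coef (rU g) (q g) (ι g) (rS g) (a g) (o g) := by
  unfold coefProd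
  exact (Finset.mul_prod_erase univ (fun g => coef (rU g) (q g) (ι g) (rS g) (a g) (o g)) (mem_univ f)).symm

/-- the `f`-erased part of `coefProd` does not see the `f`-coordinate of `ι`. -/
theorem prod_erase_update (rU rS : Fin 4 → Rel) (q : Fin 4 → ℕ) (ι a o : Fin 4 → ℕ × ℕ) (f : Fin 4) (v : ℕ × ℕ) :
    ∏ g ∈ univ.erase f, coef (rU g) (q g) (Function.update ι f v g) (rS g) (a g) (o g) =
      ∏ g ∈ univ.erase f, coef (rU g) (q g) (ι g) (rS g) (a g) (o g) := by
  refine Finset.prod_congr rfl fun g hg => ?_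
  rw [Function.update_of_ne (Finset.ne_of_mem_erase hg)]

/-- **ENGINE** (`w_ζ` kills `ξ̄_ζ`): on a factor `f` where the section class is a positive letter of phase `ζ = i^k`, the product
of the sections with the `f`-term of a demand OF PHASE `k` vanishes after summing over the unknown coordinates. -/
theorem sum_coefProd_mul_obTerm_eq_zero (rS : Fin 4 → Rel) (κ : Matrix (Fin 4) (Fin 4) ℂ) (q : Fin 4 → ℕ)
    (a o : Fin 4 → ℕ × ℕ) (f τ : Fin 4) (e : ℕ) (k : Fin 4) (hf : rS f = Rel.pos e k) :
    ∑ ι ∈ Fintype.piFinset (fun g => idx Rel.zero (q g)),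
      coefProd (fun _ => Rel.zero) rS q ι a o *
        (if τ = f then
          (if q = Pi.single f 2 then xiBar k (0, 0) * kap κ k f f (1, 0) - xiBar k (1, 0) * kap κ k f f (0, 0) else 0)
         else if q = qPair f τ then
          (if f < τ then xiBar k (ι f) * kap κ k f τ (ι τ) else -(kap κ k f τ (ι τ) * xiBar k (ι f)))
         else 0) = 0 := by
  by_cases hτ : τ = f
  · subst hτ
    simp only [if_true]
    by_cases hq : q = Pi.single τ 2
    · refine Finset.sum_eq_zero fun ι _ => ?_
      rw [coefProd_eq_zero_of_factor _ _ _ _ _ _ τ (by rw [hf, hq]; simp [coef]), zero_mul]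
    · simp [hq]
  · simp_rw [if_neg hτ]
    by_cases hq : q = qPair f τ
    · simp_rw [if_pos hq]
      have hqf : q f = 1 := by rw [hq]; simp [qPair]
      -- pair `ι` with the swap of its `f`-coordinate `ē_A ↔ ē_B`
      refine Finset.sum_involution
        (fun ι _ => Function.update ι f (if ι f = (0, 0) then ((1 : ℕ), (0 : ℕ)) else (0, 0))) ?_ ?_ ?_ ?_
      · intro ι hι
        have hιf : ι f ∈ ({(0, 0), (1, 0)} : Finset (ℕ × ℕ)) := by
          have := Fintype.mem_piFinset.mp hι f
          rwa [hqf] at this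
        rw [coefProd_eq_mul_erase _ _ _ _ _ _ f, coefProd_eq_mul_erase _ _ _ (Function.update ι f _) _ _ f,
          prod_erase_update, Function.update_self, Function.update_of_ne hτ, hf, hqf,
          coef_zero_one_pos, coef_zero_one_pos]
        simp only [Finset.mem_insert, Finset.mem_singleton] at hιf
        have hc := wCoef_xiBar_cancel k
        rcases hιf with h0 | h1
        · rw [h0]; simp only [if_true]
          split_ifs <;> first
            | linear_combination
                ((∏ g ∈ univ.erase f, coef Rel.zero (q g) (ι g) (rS g) (a g) (o g)) * kap κ k f τ (ι τ)) * hc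
            | linear_combination
                (-((∏ g ∈ univ.erase f, coef Rel.zero (q g) (ι g) (rS g) (a g) (o g)) * kap κ k f τ (ι τ))) * hc
            | linear_combination
        · rw [h1]; simp only [Prod.mk.injEq, one_ne_zero, false_and, if_false]
          split_ifs <;> first
            | linear_combination
                ((∏ g ∈ univ.erase f, coef Rel.zero (q g) (ι g) (rS g) (a g) (o g)) * kap κ k f τ (ι τ)) * hc
            | linear_combination
                (-((∏ g ∈ univ.erase f, coef Rel.zero (q g) (ι g) (rS g) (a g) (o g)) * kap κ k f τ (ι τ))) * hc
            | linear_combination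
      · intro ι hι hne h
        have := congrFun h f
        rw [Function.update_self] at this
        split_ifs at this with h0
        · rw [h0] at this; simp at this
        · exact h0 this.symm
      · intro ι hι
        refine Fintype.mem_piFinset.mpr fun g => ?_
        by_cases hg : g = f
        · subst hg; rw [Function.update_self, hqf]
          split_ifs <;> simp [idx]
        · rw [Function.update_of_ne hg]; exact Fintype.mem_piFinset.mp hι g
      · intro ι hι
        have hιf : ι f ∈ ({(0, 0), (1, 0)} : Finset (ℕ × ℕ)) := by
          have := Fintype.mem_piFinset.mp hι f
          rwa [hqf] at this
        simp only [Finset.mem_insert, Finset.mem_singleton] at hιf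
        funext g
        by_cases hg : g = f
        · subst hg
          rw [Function.update_self, Function.update_self]
          rcases hιf with h0 | h1
          · rw [h0]; simp
          · rw [h1]; simp
        · rw [Function.update_of_ne hg, Function.update_of_ne hg]
    · simp [hq]

/-- pulling a constant out of a weighted sum. -/
theorem sum_mul_const_mul {α : Type*} (s : Finset α) (C B : α → ℂ) (c : ℂ) :
    ∑ x ∈ s, C x * (c * B x) = c * ∑ x ∈ s, C x * B x := by
  rw [Finset.mul_sum]
  exact Finset.sum_congr rfl fun x _ => by ring

/-- **NATURALITY OF THE DEMAND in the model** (FAITHFULNESS (b)(ii) of `Pad4FirstOrderModel.lean`, now PROVED):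
for constituents `P″`, `P` and a section `g ∈ H⁰(P″ − P)` (coordinates on `idxH0 P″ P`; the statement is vacuous when
there are none), the products `ob_κ(P″)·g` and `ob_κ(P)·g` in `H²(P″ − P)` COINCIDE, coordinate by coordinate — i.e.
`(ob_κ(P″) − ob_κ(P))·g = 0`: on every factor where `P″` and `P` differ the section class is a positive letter `e ℓ_ζ`,
the `V_f`-factor of the corresponding term of `κ ∪ c₁(P″ − P)` is `ξ̄_ζ`, and `V·R_e → R_e ⊗ W` is `w_ζ` with
`w_ζ(ξ̄_ζ) = 0` (`sum_coefProd_mul_obTerm_eq_zero`). This is the identity under which (E1) is invariant under a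
unipotent change of splitting of `E₊` with section entries (PAD4-THEOREM-L v1.2 §2–§3, the step the cell's pencil proof
of THEOREM L^ζ uses); proving it does NOT prove `TheoremLZeta` (kernel-OPEN). -/
theorem ob_mul_section_natural (P'' P : Constituent) (κ : Matrix (Fin 4) (Fin 4) ℂ)
    (g : (Fin 4 → ℕ × ℕ) → ℂ) (q : Fin 4 → ℕ) (o : Fin 4 → ℕ × ℕ) :
    (∑ ι ∈ Fintype.piFinset (fun f => idx Rel.zero (q f)), ∑ a ∈ idxH0 P'' P,
        coefProd (fun _ => Rel.zero) (rel P'' P) q ι a o * ob P'' κ q ι * g a) =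
    ∑ ι ∈ Fintype.piFinset (fun f => idx Rel.zero (q f)), ∑ a ∈ idxH0 P'' P,
        coefProd (fun _ => Rel.zero) (rel P'' P) q ι a o * ob P κ q ι * g a := by
  rw [Finset.sum_comm, Finset.sum_comm (f := fun ι a => coefProd (fun _ => Rel.zero) (rel P'' P) q ι a o * ob P κ q ι * g a)]
  refine Finset.sum_congr rfl fun a ha => ?_
  rw [← Finset.sum_mul, ← Finset.sum_mul]
  congr 1
  -- the `ι`-sum of `coefProd · ob` is the same for `P″` and `P`, factor term by factor term
  simp only [ob, Finset.mul_sum]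
  rw [Finset.sum_comm, Finset.sum_comm (f := fun ι f => ∑ τ : Fin 4, coefProd (fun _ => Rel.zero) (rel P'' P) q ι a o * _)]
  refine Finset.sum_congr rfl fun f _ => ?_
  rw [Finset.sum_comm, Finset.sum_comm (f := fun ι τ => coefProd (fun _ => Rel.zero) (rel P'' P) q ι a o * _)]
  refine Finset.sum_congr rfl fun τ _ => ?_
  rw [sum_mul_const_mul, sum_mul_const_mul]
  have hmem : (idx (rel P'' P f) 0).Nonempty := ⟨a f, Fintype.mem_piFinset.mp ha f⟩
  rcases rel_eq_of_idx_zero_nonempty P'' P f hmem with ⟨_, hc, hp⟩ | ⟨hr, _, hp⟩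
  · -- equal letters on `f` (or both uncharged): the two `f`-terms coincide
    rcases hp with h0 | hph
    · have h0' : P''.charge f = 0 := by omega
      simp [h0, h0']
    · rw [hc, hph]
  · -- `P″ − P` is the positive letter `(c″ − c) ℓ_ζ` on `f`, `ζ` = the phase of `P″`: both `f`-terms vanish
    have E := sum_coefProd_mul_obTerm_eq_zero (rel P'' P) κ q a o f τ _ _ hr
    rw [E, mul_zero]
    rcases hp with h0 | hph
    · simp [h0]
    · rw [← hph, E, mul_zero]

end Summit.Ventures.HSemireg.Pad4FirstOrder

end
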